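import Summits.ABC.IUTFork.Thm311LogKummer
import Literature.IUT.LogThetaLattice.VerticallyCoricLGP
import HarnessLib

/-!
# [IUTchIII] Theorem 3.11 in the author's terms — dictionary, archimedean half of (Ind3)

Record-only file (D-0012) of the abc-iut cell (Cor. 3.12 crew, seat abc-iut-c312-1, gen 3); TAKES NO SIDE. Sequel to
the seat's `Thm311Dictionary` (I), whose `Column.ind3_non_of_prop35ii_a` bridges the NON-archimedean clause of the
typed (Ind3) (`Thm311LogKummer`, file C: `Column.Ind3`) to abc-iut-L6-t4's typing `Prop35ii_a` of [IUTchIII]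
Prop. 3.5 (ii) (a). This file supplies the ARCHIMEDEAN twin over L6-t4's `Prop35ii_b` ([IUTchIII] Prop. 3.5 (ii)
(b), kurims May 2020 `paper:url-4b091feeb646` p. 105: «the closed unit ball `𝓘(^{S^±_{j+1}}𝓕(^{n,∘}𝔇_≻)_{v_ℚ})` …
contains the image … of both (1) the groups of units … and (2) the closed balls of radius `π` …»; «a closed ball as
in (2) contains, for each `m' ≥ 1`, a subset that surjects, via the `m'`-th iterate of the log-link …, onto the
subset of the group of units … on which this iterate is defined») and the assembly of `Column.Ind3` from the two
clauses — the pieces a discharge prover needs to close the cone node IUTchIII:Thm3.11(ii) at the strictified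
packet model (abc-iut-c312-5 `Column.partII_iff_ind3_of_coric`: there (ii) AS TYPED ⟺ (Ind3)), with L6-t4's
`prop35ii_a_shellPacketAt_ofUnitLog` (non-archimedean) and `prop35ii_b_arcExp` (archimedean) as inputs. Bookkeeping
only: the typed (Ind3) records CONTAINMENTS («upper semi-compatible»); the surjectivity content of (b) is carried by
the choice of the subset `S` and is not otherwise used. [claim: Mochizuki2012, status: disputed]
Deliberately NOT here: the instance itself (a w4 discharge row); any judgement.
-/

namespace Summit.ABC.IUTFork.Thm311.Column

open Literature.IUT.LogThetaLattice

variable {T : ThetaIndex} {L : LogShells T} (C : Column L) (D : MRData L)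

/-- DICTIONARY/BRIDGE (archimedean twin of `ind3_non_of_prop35ii_a`): if, at an archimedean `(j, v_ℚ)`, the
column's unit images for `m' = 0` ARE the Kummer images `κ m '' U m` of the unit groups, its ball images ARE the
Kummer images `κ m '' B m` of the radius-`π` balls, and its unit images through the `m'`-th log-iterate
(`m' ≥ 1`) are Kummer images of subsets of those balls (Prop. 3.5 (ii) (b): «a closed ball as in (2) contains, for
each `m' ≥ 1`, a subset that surjects … onto the subset of the group of units … on which this iterate is
defined»), then `Prop35ii_b` yields the three archimedean containments of `Column.Ind3`.
[claim: Mochizuki2012, status: disputed] -/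
theorem ind3_arc_of_prop35ii_b (j : T.Label) (vQ : T.VQ) {G : ℤ → Type} (U B : ∀ m, Set (G m))
    (κ : ∀ m, G m → L.Packet j vQ) (lam : ∀ (m : ℤ) (m' : ℕ), G m → Option (G (m - m')))
    (Dom : ∀ (m : ℤ) (m' : ℕ), Set (G m)) (h : Prop35ii_b (D.shellPk j vQ) G U B κ lam Dom)
    (h0 : ∀ m, C.unitImage m 0 j vQ = κ m '' U m) (hB : ∀ m, C.ballImage m j vQ = κ m '' B m)
    (hS : ∀ (m : ℤ) (m' : ℕ), 1 ≤ m' → ∃ S ⊆ B m, C.unitImage (m - m') m' j vQ = κ m '' S) (m : ℤ) :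
    C.unitImage m 0 j vQ ⊆ D.shellPk j vQ ∧ C.ballImage m j vQ ⊆ D.shellPk j vQ ∧
      ∀ m' : ℕ, 1 ≤ m' → C.unitImage (m - m') m' j vQ ⊆ C.ballImage m j vQ := by
  refine ⟨?_, ?_, fun m' hm' => ?_⟩
  · rw [h0 m]; exact h.1 m
  · rw [hB m]; exact h.2.1 m
  · obtain ⟨S, hSB, hU⟩ := hS m m' hm'
    rw [hU, hB m]
    exact Set.image_mono hSB

/-- The subset `S ⊆ B m` of Prop. 3.5 (ii) (b) (surjecting, via the `m'`-th log-iterate, onto the definable units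
at `m − m'`) supplies the binding asked for by `ind3_arc_of_prop35ii_b`: with `unitImage (m − m') m' := κ m '' S`
for THAT subset, the hypothesis `hS` holds. [claim: Mochizuki2012, status: disputed] -/
theorem exists_ball_subset_of_prop35ii_b (j : T.Label) (vQ : T.VQ) {G : ℤ → Type} (U B : ∀ m, Set (G m))
    (κ : ∀ m, G m → L.Packet j vQ) (lam : ∀ (m : ℤ) (m' : ℕ), G m → Option (G (m - m')))
    (Dom : ∀ (m : ℤ) (m' : ℕ), Set (G m)) (h : Prop35ii_b (D.shellPk j vQ) G U B κ lam Dom) (m : ℤ) (m' : ℕ)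
    (hm' : 1 ≤ m') :
    ∃ S ⊆ B m, {y | ∃ x ∈ S, lam m m' x = some y} = U (m - m') ∩ {y | ∃ x ∈ Dom (m - m') m', y = x} :=
  h.2.2 m m' hm'

/-- ASSEMBLY of the typed (Ind3) from its two clauses, place by place: the non-archimedean containments
(e.g. from `ind3_non_of_prop35ii_a`) and the archimedean ones (e.g. from `ind3_arc_of_prop35ii_b`). [folklore] -/
theorem ind3_of_clauses
    (hnon : ∀ (j : T.Label) (vQ : T.VQ), T.IsNon vQ → ∀ (m : ℤ) (m' : ℕ), C.unitImage m m' j vQ ⊆ D.shellPk j vQ)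
    (harc : ∀ (j : T.Label) (vQ : T.VQ), ¬ T.IsNon vQ → ∀ m : ℤ,
      C.unitImage m 0 j vQ ⊆ D.shellPk j vQ ∧ C.ballImage m j vQ ⊆ D.shellPk j vQ ∧
        ∀ m' : ℕ, 1 ≤ m' → C.unitImage (m - m') m' j vQ ⊆ C.ballImage m j vQ) :
    C.Ind3 D :=
  ⟨fun m m' j vQ hv => hnon j vQ hv m m', fun m j vQ hv => harc j vQ hv m⟩

/-- Conversely the typed (Ind3) IS the conjunction of the two clauses (nothing else is recorded by it: the
"upper semi-compatibility" as containments). [folklore] -/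
theorem ind3_iff_clauses :
    C.Ind3 D ↔
      (∀ (j : T.Label) (vQ : T.VQ), T.IsNon vQ → ∀ (m : ℤ) (m' : ℕ), C.unitImage m m' j vQ ⊆ D.shellPk j vQ) ∧
      ∀ (j : T.Label) (vQ : T.VQ), ¬ T.IsNon vQ → ∀ m : ℤ,
        C.unitImage m 0 j vQ ⊆ D.shellPk j vQ ∧ C.ballImage m j vQ ⊆ D.shellPk j vQ ∧
          ∀ m' : ℕ, 1 ≤ m' → C.unitImage (m - m') m' j vQ ⊆ C.ballImage m j vQ :=
  ⟨fun h => ⟨fun j vQ hv m m' => h.1 m m' j vQ hv, fun j vQ hv m => h.2 m j vQ hv⟩,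
    fun h => C.ind3_of_clauses D h.1 h.2⟩

end Summit.ABC.IUTFork.Thm311.Column
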